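import Literature.NumberTheory.Automorphic.ArchComplexPlaceCasimir
import Literature.NumberTheory.Automorphic.ArchCoefficientModule
import Literature.NumberTheory.DiophantineGeometry.WeylModuleOneRowForms
import HarnessLib

/-!
# The coefficient module `E_wt = ⨂_τ V_wt(ℂ)` along the factor `𝔤𝔩ₙ(ℂ) = 𝔤𝔩ₙ(K_w)` at a complex place:
# the scalars of `C₊`, `C₋`, `Z(u)` (and the Casimir scalar of `V_wt(ℂ)` for `n = 2`)

Topic `NumberTheory/Automorphic`; continues `ArchComplexPlaceCasimir` (the factor `φ_w : 𝔤𝔩ₙ(ℂ) ↪ 𝔤`, its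
Casimir tensors, and the comparison of the scalars of `C_±`, `Z(u)` on the two factors of a non-vanishing
`H^q(𝔤, K_∞; V ⊗ W)`) on the COEFFICIENT side `W = E_wt(ℂ)` (`ParallelWeight.archCoeffRep/archCoeffLie` of
`ArchCoefficientModule`).  Everything is proved; the definitions are auxiliary operators with bodies.

* `leib n d M = ∑_i 1 ⊗ ⋯ ⊗ M ⊗ ⋯ ⊗ 1` on `(ℂⁿ)^{⊗d}` (`leib_tprod`), `stdPowLie_eq_leib`; `tens` (underlying
  tensor of `v ∈ V_wt(ℂ) = S_μ(ℂⁿ)`), **`tens_factorLie`**: the differential of `V_wt(ℂ) ∘ GLₙ(τ̃)` is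
  `L(τ̃ X) + λ_{n−1} tr(τ̃ X)`;
* the extensions `τ̃` on the factor: `σ̃_w(φ_w Y) = Y`, `(conj σ_w)~(φ_w Y) = Ȳ`, `τ̃(φ_w Y) = 0` off `w`
  (`map_embeddingExt_complexPlaceLie_self/_conj/_of_ne`);
* `algLie n wt w = A := dV_wt ∘ φ_w` (the complex-linear differential of the algebraic representation `V_wt` of
  `GLₙ(ℂ)`, as `(factorLie σ_w) ∘ φ_w`; `tens_algLie`, `algLie_smul`), `coeffLieT` (`= archCoeffLie` on the honest
  `PiTensorProduct`, `rfl`) and **`coeffLieT_placeLie`**: `dE_wt(φ_w Y) = slot_{σ_w}(A Y) + slot_{σ̄_w}(A Ȳ)`;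
* **`coeffRepGL_conj_algLie`** (`V_wt(g) A(Y) V_wt(g)⁻¹ = A(g Y g⁻¹)`, from `conj_dτ` at `placeGL`), the Casimir
  operator `casAlg = ∑ A(E_{ab}) A(E_{ba})`, `lift_algLie_casPlus = 2 casAlg`, `lift_algLie_casMinus = 2i casAlg`,
  `lift_algLie_casPlus_comm` (`Ad`-invariance of the `B₊`-tensor) and **`exists_casAlg_eq_smul`: `C^alg` is a
  scalar on `V_wt(ℂ)`** — Schur's lemma (Mathlib `Representation.IsIrreducible.algebraMap_intertwiningMap_
  bijective_of_isAlgClosed`) for the irreducible Weyl module (`isIrreducible_weylRep_holds`, Fulton–Harris 6.3);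
* **`lift_coeffLieT_casPlus/casMinus/zedU`**: `dE_wt(φ_w C₊) = S(A C₊) + T(A C₊)`, `dE_wt(φ_w C₋) = S(A C₋) − T(A C₋)`,
  `dE_wt(φ_w Z(u)) = S(A(u·1)) + T(A(ū·1))` (`S = slot_{σ_w}`, `T = slot_{σ̄_w}`), hence given `C^alg = c`:
  `C₊ ↦ 4c`, `C₋ ↦ 0`, `Z(u) ↦ (u + ū)(d + n λ_{n−1})`;
* `n = 2`, `wt` dominant: `coeffPartition wt = (d)`, `d = λ₀ − λ₁`, the highest weight vector `v⁺ = e₀^{⊗d} ∈ V_wt(ℂ)`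
  (`hwVec`), the values `A(E₀₀)v⁺ = (d+m)v⁺`, `A(E₁₁)v⁺ = m v⁺`, `A(E₀₁)v⁺ = 0`, `A(E₀₁)A(E₁₀)v⁺ = d v⁺` and
  **`casAlg_two_eq`: `C^alg = (λ₀² + λ₁² + λ₀ − λ₁) · 1`**; finally **`archCoeffLie_lift_casPlus`**
  (`C₊,w ↦ 4(λ₀² + λ₁² + λ₀ − λ₁)`), **`archCoeffLie_lift_casMinus`** (`↦ 0`), **`archCoeffLie_lift_zedU`**
  (`Z_w(u) ↦ (u + ū)(λ₀ + λ₁)`) on `ParallelWeight.CoeffModule ℂ F 2 wt`.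

These are the coefficient-side inputs of the `GL₂` Wigner lemma `hasInfinityType_of_cohomologyWt_ne_zero`.

## References

* A. Borel, N. Wallach (2000), 0 §2.3–2.5, I §4.1. [BorelWallach2000]
* A. W. Knapp, *Lie Groups Beyond an Introduction*, 2nd ed. (2002), §V.4 (5.24). [Knapp2002]
* W. Fulton, J. Harris, *Representation Theory*, GTM 129 (1991), §6.1 Thm. 6.3, §8.1, §15.5. [FultonHarrisGTM129]
* W. Fulton, *Young Tableaux* (1997), §8.2 Lemma 4. [FultonYoungTableaux1997]
-/

noncomputable section

-- Mathlib idiom (Mathlib/Algebra/Lie/OfAssociative.lean), as in `GKModules` / `ArchCoefficientModule`: commutator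
-- brackets on matrix algebras and on `Module.End`.
attribute [local instance 100] LieRing.ofAssociativeRing

open scoped Matrix ComplexConjugate TensorProduct
open Complex UniversalEnvelopingAlgebra

namespace Literature.NumberTheory.Automorphic

namespace ComplexPlace

open scoped Classical
open _root_.NumberField _root_.NumberField.InfinitePlace _root_.NumberField.mixedEmbedding GLnComplexCasimir

/-! ## The coefficient side: `E_wt` restricted to the factor at `w` -/

section Coefficients

open RealMatrixGroup ParallelWeight GLnCohomology Literature.NumberTheory.DiophantineGeometry PiTensor

variable {F : Type} [Field F] [NumberField F] (n : ℕ) (wt : Fin n → ℤ)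
  (w : {w : InfinitePlace F // IsComplex w})

/-! ### The Leibniz operator of a complex matrix on a tensor power of `ℂⁿ` -/

/-- The Leibniz operator `L(M) = ∑_i 1 ⊗ ⋯ ⊗ M ⊗ ⋯ ⊗ 1` of `M ∈ 𝔤𝔩ₙ(ℂ)` on `(ℂⁿ)^{⊗d}` (the differential
of `g ↦ g^{⊗d}`). [cite: FultonHarrisGTM129, §8.1] -/
def leib (d : ℕ) (M : Matrix (Fin n) (Fin n) ℂ) : Module.End ℂ (TensorPower ℂ d (Fin n → ℂ)) :=
  ∑ i : Fin d, PiTensor.slot (E := fun _ : Fin d => Fin n → ℂ) i (Matrix.toLin' M)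

variable {n}

omit [NumberField F] in
/-- `slot i 0 = 0`. [folklore] -/
theorem slot_zero' {ι : Type*} [DecidableEq ι] {E : ι → Type*} [∀ i, AddCommGroup (E i)]
    [∀ i, Module ℂ (E i)] (i : ι) : PiTensor.slot (E := E) i 0 = 0 := by
  simpa using PiTensor.slot_smul (E := E) i (0 : ℂ) 0

/-- `slot i 1 = 1`. [folklore] -/
theorem slot_one' {ι : Type*} [DecidableEq ι] {E : ι → Type*} [∀ i, AddCommGroup (E i)]
    [∀ i, Module ℂ (E i)] (i : ι) : PiTensor.slot (E := E) i 1 = 1 := by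
  rw [PiTensor.slot, Function.update_eq_self, PiTensorProduct.map_one]

/-- `slot i` is additive over finite sums. [folklore] -/
theorem slot_sum' {ι : Type*} [DecidableEq ι] {E : ι → Type*} [∀ i, AddCommGroup (E i)]
    [∀ i, Module ℂ (E i)] (i : ι) {κ : Type*} (s : Finset κ) (u : κ → (E i →ₗ[ℂ] E i)) :
    PiTensor.slot (E := E) i (∑ k ∈ s, u k) = ∑ k ∈ s, PiTensor.slot (E := E) i (u k) := by
  classical
  induction s using Finset.induction_on with
  | empty => simp [slot_zero']
  | insert a s ha ih => rw [Finset.sum_insert ha, Finset.sum_insert ha, PiTensor.slot_add, ih]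

/-- The Leibniz operator on pure tensors. [cite: FultonHarrisGTM129, §8.1] -/
theorem leib_tprod (d : ℕ) (M : Matrix (Fin n) (Fin n) ℂ) (f : Fin d → Fin n → ℂ) :
    leib n d M (PiTensorProduct.tprod ℂ f) =
      ∑ i, PiTensorProduct.tprod ℂ (Function.update f i (M *ᵥ f i)) := by
  rw [leib, LinearMap.sum_apply]
  exact Finset.sum_congr rfl fun i _ => by rw [PiTensor.slot_tprod, Matrix.toLin'_apply]

/-- `L` is additive. [folklore] -/
theorem leib_add (d : ℕ) (M M' : Matrix (Fin n) (Fin n) ℂ) : leib n d (M + M') = leib n d M + leib n d M' := by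
  simp [leib, map_add, PiTensor.slot_add, Finset.sum_add_distrib]

/-- `L` is homogeneous. [folklore] -/
theorem leib_smul (d : ℕ) (c : ℂ) (M : Matrix (Fin n) (Fin n) ℂ) : leib n d (c • M) = c • leib n d M := by
  simp [leib, map_smul, PiTensor.slot_smul, Finset.smul_sum]

/-- `L(0) = 0`. [folklore] -/
theorem leib_zero (d : ℕ) : leib n d (0 : Matrix (Fin n) (Fin n) ℂ) = 0 := by
  simp [leib, slot_zero']

/-- `L(u · 1) = d u` on `d`-fold tensors. [folklore] -/
theorem leib_smul_one (d : ℕ) (u : ℂ) : leib n d (u • (1 : Matrix (Fin n) (Fin n) ℂ)) = ((d : ℂ) * u) • 1 := by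
  rw [leib_smul, leib, Matrix.toLin'_one, ← Module.End.one_eq_id]
  simp only [slot_one', Finset.sum_const, Finset.card_univ, Fintype.card_fin]
  rw [← Nat.cast_smul_eq_nsmul ℂ, smul_smul, mul_comm]

variable (n) in
/-- The Leibniz differential of the tensor power through `τ̃` is `L(τ̃(X))`. [folklore] -/
theorem stdPowLie_eq_leib (τ : F →+* ℂ) (d : ℕ) (X : (archGroupGL n F).lie) :
    stdPowLie F n τ d X = leib n d ((X : Matrix (Fin n) (Fin n) (mixedSpace F)).map (embeddingExt τ)) := by
  rw [stdPowLie, PiTensor.piLie_apply]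
  exact Finset.sum_congr rfl fun i _ => rfl

/-! ### The underlying tensor of an element of `V_wt(ℂ)` and the differential `factorLie` -/

/-- The underlying tensor of `v ∈ V_wt(ℂ) = S_μ(ℂⁿ) ⊆ (ℂⁿ)^{⊗d}`. [folklore] -/
def tens (v : GLnCohomology.CoeffModule ℂ n wt) : TensorPower ℂ (coeffDegree wt) (Fin n → ℂ) :=
  ((show ↥(weylModule ℂ (Fin n) (coeffPartition wt)) from v) : TensorPower ℂ (coeffDegree wt) (Fin n → ℂ))

/-- `tens` is injective. [folklore] -/
theorem tens_injective : Function.Injective (tens wt (n := n)) := Subtype.val_injective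

/-- `tens` lands in the Weyl module. [folklore] -/
theorem tens_mem (v : GLnCohomology.CoeffModule ℂ n wt) : tens wt v ∈ weylModule ℂ (Fin n) (coeffPartition wt) :=
  Subtype.property _

/-- Additivity. [folklore] -/
@[simp] theorem tens_add (v v' : GLnCohomology.CoeffModule ℂ n wt) : tens wt (v + v') = tens wt v + tens wt v' := rfl

/-- Homogeneity. [folklore] -/
@[simp] theorem tens_smul (c : ℂ) (v : GLnCohomology.CoeffModule ℂ n wt) : tens wt (c • v) = c • tens wt v := rfl

/-- Zero. [folklore] -/
@[simp] theorem tens_zero : tens wt (0 : GLnCohomology.CoeffModule ℂ n wt) = 0 := rfl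

/-- The element of `V_wt(ℂ)` with a given underlying tensor. [folklore] -/
def ofTens (t : TensorPower ℂ (coeffDegree wt) (Fin n → ℂ)) (ht : t ∈ weylModule ℂ (Fin n) (coeffPartition wt)) :
    GLnCohomology.CoeffModule ℂ n wt :=
  show ↥(weylModule ℂ (Fin n) (coeffPartition wt)) from ⟨t, ht⟩

/-- Unfolding. [folklore] -/
@[simp] theorem tens_ofTens (t : TensorPower ℂ (coeffDegree wt) (Fin n → ℂ))
    (ht : t ∈ weylModule ℂ (Fin n) (coeffPartition wt)) : tens wt (ofTens wt t ht) = t := rfl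

variable (n) in
/-- **The differential of `V_wt(ℂ) ∘ GLₙ(τ̃)` on underlying tensors**: `L(τ̃ X) + λ_{n−1} tr(τ̃ X)`.
[cite: BorelWallach2000, 0 §2.3] -/
theorem tens_factorLie (τ : F →+* ℂ) (X : (archGroupGL n F).lie) (v : GLnCohomology.CoeffModule ℂ n wt) :
    tens wt (factorLie F n wt τ X v) =
      leib n (coeffDegree wt) ((X : Matrix (Fin n) (Fin n) (mixedSpace F)).map (embeddingExt τ)) (tens wt v) +
        ((lowestEntry wt : ℂ) * ((X : Matrix (Fin n) (Fin n) (mixedSpace F)).map (embeddingExt τ)).trace) • tens wt v := by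
  rw [← stdPowLie_eq_leib]
  rfl

/-! ### The extensions `τ̃` on the factor at `w` -/

omit [NumberField F] in
/-- `σ̃_w = ev_w`. [folklore] -/
theorem embeddingExt_embedding : embeddingExt w.1.embedding = evalComplexAlgHom F w := by
  have hw : ¬ (InfinitePlace.mk w.1.embedding).IsReal := by
    rw [mk_embedding]; exact not_isReal_iff_isComplex.mpr w.2
  rw [embeddingExt_of_eq hw (by rw [mk_embedding])]
  congr 1
  exact Subtype.ext (mk_embedding w.1)

omit [NumberField F] in
/-- `conj σ_w ≠ σ_w` at a complex place. [folklore] -/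
theorem conjugate_embedding_ne : ComplexEmbedding.conjugate w.1.embedding ≠ w.1.embedding := fun h =>
  (not_isReal_iff_isComplex.mpr w.2) (isReal_iff.mpr (ComplexEmbedding.isReal_iff.mpr h))

omit [NumberField F] in
/-- `(conj σ_w)~ = conj ∘ ev_w`. [folklore] -/
theorem embeddingExt_conjugate_embedding :
    embeddingExt (ComplexEmbedding.conjugate w.1.embedding) =
      Complex.conjAe.toAlgHom.comp (evalComplexAlgHom F w) := by
  have hw : ¬ (InfinitePlace.mk (ComplexEmbedding.conjugate w.1.embedding)).IsReal := by
    rw [mk_conjugate_eq, mk_embedding]; exact not_isReal_iff_isComplex.mpr w.2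
  have hne : (InfinitePlace.mk (ComplexEmbedding.conjugate w.1.embedding)).embedding ≠
      ComplexEmbedding.conjugate w.1.embedding := by
    rw [mk_conjugate_eq, mk_embedding]; exact (conjugate_embedding_ne w).symm
  rw [embeddingExt_of_ne hw hne]
  congr 2
  exact Subtype.ext (by
    show InfinitePlace.mk (ComplexEmbedding.conjugate w.1.embedding) = w.1
    rw [mk_conjugate_eq, mk_embedding])

omit [NumberField F] in
/-- `σ̃_w(φ_w Y) = Y`. [folklore] -/
theorem map_embeddingExt_complexPlaceLie_self (Y : Matrix (Fin n) (Fin n) ℂ) :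
    (complexPlaceLie n w Y).map (embeddingExt w.1.embedding) = Y := by
  rw [embeddingExt_embedding]
  ext i j
  simp [complexPlaceLie_apply]

omit [NumberField F] in
/-- `(conj σ_w)~(φ_w Y) = Ȳ`. [folklore] -/
theorem map_embeddingExt_complexPlaceLie_conj (Y : Matrix (Fin n) (Fin n) ℂ) :
    (complexPlaceLie n w Y).map (embeddingExt (ComplexEmbedding.conjugate w.1.embedding)) = Y.map conj := by
  rw [embeddingExt_conjugate_embedding]
  ext i j
  simp [complexPlaceLie_apply]

omit [NumberField F] in
/-- `τ̃(φ_w Y) = 0` for `τ` off the place `w`. [folklore] -/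
theorem map_embeddingExt_complexPlaceLie_of_ne {τ : F →+* ℂ} (hτ : InfinitePlace.mk τ ≠ w.1)
    (Y : Matrix (Fin n) (Fin n) ℂ) : (complexPlaceLie n w Y).map (embeddingExt τ) = 0 := by
  ext i j
  rw [Matrix.map_apply, complexPlaceLie_apply, Matrix.zero_apply]
  by_cases hr : (InfinitePlace.mk τ).IsReal
  · rw [embeddingExt_of_isReal hr, evalRealAlgHom_apply]
    rfl
  · have hne : (⟨InfinitePlace.mk τ, not_isReal_iff_isComplex.mp hr⟩ : {w : InfinitePlace F // IsComplex w}) ≠ w :=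
      fun h => hτ (congrArg Subtype.val h)
    by_cases he : (InfinitePlace.mk τ).embedding = τ
    · rw [embeddingExt_of_eq hr he, evalComplexAlgHom_apply]
      exact Pi.single_eq_of_ne hne _
    · rw [embeddingExt_of_ne hr he, AlgHom.comp_apply, evalComplexAlgHom_apply]
      change conj ((Pi.single w (Y i j) : {w : InfinitePlace F // IsComplex w} → ℂ) ⟨InfinitePlace.mk τ, _⟩) = 0
      rw [Pi.single_eq_of_ne hne, map_zero]

omit [NumberField F] in
/-- An embedding inducing the place `w` is `σ_w` or its conjugate. [folklore] -/
theorem eq_or_eq_of_mk_eq {τ : F →+* ℂ} (hτ : InfinitePlace.mk τ = w.1) :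
    τ = w.1.embedding ∨ τ = ComplexEmbedding.conjugate w.1.embedding := by
  rw [← mk_embedding w.1, mk_eq_iff] at hτ
  rcases hτ with h | h
  · exact Or.inl h
  · right; rw [← h]; ext x; simp

/-! ### The algebraic action `A(Y)` of `𝔤𝔩ₙ(ℂ)` on `V_wt(ℂ)` and the restriction of `E_wt` to the factor -/

variable (n) in
/-- **`A = dV_wt ∘ φ_w`**: the factor `V_wt(ℂ) ∘ GLₙ(σ̃_w)` differentiated along the factor `𝔤𝔩ₙ(ℂ) = 𝔤𝔩ₙ(K_w)`,
i.e. the (complex-linear) differential of the algebraic representation `V_wt` of `GLₙ(ℂ)`, as a real Lie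
algebra morphism. [cite: BorelWallach2000, 0 §2.3] -/
def algLie : Matrix (Fin n) (Fin n) ℂ →ₗ⁅ℝ⁆ Module.End ℂ (GLnCohomology.CoeffModule ℂ n wt) :=
  (factorLie F n wt w.1.embedding).comp (placeLie n w)

/-- `A(Y)` on underlying tensors: `L(Y) + λ_{n−1} tr(Y)`. [cite: BorelWallach2000, 0 §2.3] -/
theorem tens_algLie (Y : Matrix (Fin n) (Fin n) ℂ) (v : GLnCohomology.CoeffModule ℂ n wt) :
    tens wt (algLie n wt w Y v) =
      leib n (coeffDegree wt) Y (tens wt v) + ((lowestEntry wt : ℂ) * Y.trace) • tens wt v := by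
  rw [algLie, LieHom.comp_apply, tens_factorLie, coe_placeLie, map_embeddingExt_complexPlaceLie_self]

/-- `A` is complex-linear. [folklore] -/
theorem algLie_smul (c : ℂ) (Y : Matrix (Fin n) (Fin n) ℂ) : algLie n wt w (c • Y) = c • algLie n wt w Y := by
  refine LinearMap.ext fun v => tens_injective wt ?_
  rw [LinearMap.smul_apply, tens_smul, tens_algLie, tens_algLie, leib_smul, Matrix.trace_smul, smul_eq_mul,
    smul_add, LinearMap.smul_apply, smul_smul, mul_left_comm]

/-- The conjugate factor along `φ_w` is `A(Ȳ)`. [folklore] -/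
theorem factorLie_conjugate_placeLie (Y : Matrix (Fin n) (Fin n) ℂ) :
    factorLie F n wt (ComplexEmbedding.conjugate w.1.embedding) (placeLie n w Y) = algLie n wt w (Y.map conj) := by
  refine LinearMap.ext fun v => tens_injective wt ?_
  rw [tens_factorLie, coe_placeLie, map_embeddingExt_complexPlaceLie_conj, tens_algLie]

/-- The factors off `w` vanish along `φ_w`. [folklore] -/
theorem factorLie_placeLie_of_ne {τ : F →+* ℂ} (hτ : InfinitePlace.mk τ ≠ w.1) (Y : Matrix (Fin n) (Fin n) ℂ) :
    factorLie F n wt τ (placeLie n w Y) = 0 := by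
  refine LinearMap.ext fun v => tens_injective wt ?_
  rw [tens_factorLie, coe_placeLie, map_embeddingExt_complexPlaceLie_of_ne w hτ, leib_zero, Matrix.trace_zero,
    mul_zero, zero_smul, add_zero, LinearMap.zero_apply, LinearMap.zero_apply, tens_zero]

variable (F n) in
/-- The Leibniz differential of `E_wt(ℂ) = ⨂_τ V_wt(ℂ) ∘ GLₙ(τ̃)` on the honest `PiTensorProduct` (the tree's
`archCoeffLie` is this map transported to the synonym `ParallelWeight.CoeffModule`). [cite: BorelWallach2000, 0 §2.3] -/
def coeffLieT : (archGroupGL n F).lie →ₗ⁅ℝ⁆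
    Module.End ℂ (⨂[ℂ] _τ : (F →+* ℂ), GLnCohomology.CoeffModule ℂ n wt) :=
  PiTensor.piLie (archGroupGL n F) fun τ => factorLie F n wt τ

/-- `archCoeffLie` is `coeffLieT` (definitionally). [folklore] -/
theorem archCoeffLie_eq_coeffLieT : archCoeffLie F n wt = coeffLieT F n wt := rfl

/-- **`E_wt` along the factor at `w`**: `dE_wt(φ_w Y) = 1 ⊗ ⋯ ⊗ A(Y)_{σ_w} ⊗ ⋯ ⊗ 1 + 1 ⊗ ⋯ ⊗ A(Ȳ)_{σ̄_w} ⊗ ⋯ ⊗ 1`.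
[cite: BorelWallach2000, 0 §2.3] -/
theorem coeffLieT_placeLie (Y : Matrix (Fin n) (Fin n) ℂ) :
    coeffLieT F n wt (placeLie n w Y) =
      PiTensor.slot (E := fun _ : (F →+* ℂ) => GLnCohomology.CoeffModule ℂ n wt) w.1.embedding (algLie n wt w Y) +
        PiTensor.slot (E := fun _ : (F →+* ℂ) => GLnCohomology.CoeffModule ℂ n wt)
          (ComplexEmbedding.conjugate w.1.embedding) (algLie n wt w (Y.map conj)) := by
  rw [coeffLieT, PiTensor.piLie_apply, Fintype.sum_eq_add w.1.embedding (ComplexEmbedding.conjugate w.1.embedding)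
    (conjugate_embedding_ne w).symm]
  · rw [factorLie_conjugate_placeLie]
    rfl
  · rintro τ ⟨h1, h2⟩
    have hτ : InfinitePlace.mk τ ≠ w.1 := fun h => by
      rcases eq_or_eq_of_mk_eq w h with h' | h'
      · exact h1 h'
      · exact h2 h'
    rw [factorLie_placeLie_of_ne wt w hτ, slot_zero']

/-! ### `A` is the differential of `V_wt(ℂ)`: conjugation by `GLₙ(ℂ)` and the Casimir operator `C^alg` -/

/-- **`V_wt(g) A(Y) V_wt(g)⁻¹ = A(g Y g⁻¹)`** (`conj_dτ` of the differentiable factor at `ι_w g`).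
[cite: BorelWallach2000, 0 §2.5 1)] -/
theorem coeffRepGL_conj_algLie (g : GL (Fin n) ℂ) (Y : Matrix (Fin n) (Fin n) ℂ) :
    coeffRepGL ℂ n wt g ∘ₗ algLie n wt w Y ∘ₗ coeffRepGL ℂ n wt g⁻¹ =
      algLie n wt w ((g : Matrix (Fin n) (Fin n) ℂ) * Y * ((g⁻¹ : GL (Fin n) ℂ) : Matrix (Fin n) (Fin n) ℂ)) := by
  have h := (isDifferentiableRep_factor F n wt w.1.embedding).conj_dτ (placeGL n w g) (placeLie n w Y)
  have hmap : Matrix.GeneralLinearGroup.map (embeddingExt w.1.embedding : mixedSpace F →+* ℂ)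
      ((placeGL n w g : (archGroupGL n F).carrier) : GL (Fin n) (mixedSpace F)) = g := by
    rw [embeddingExt_embedding]; exact evalGL_placeGL n w g
  have h1 : factorRep F n wt w.1.embedding (placeGL n w g) = coeffRepGL ℂ n wt g := by
    refine LinearMap.ext fun v => ?_
    rw [factorRep_apply, hmap]
  have h2 : factorRep F n wt w.1.embedding (placeGL n w g)⁻¹ = coeffRepGL ℂ n wt g⁻¹ := by
    refine LinearMap.ext fun v => ?_
    rw [factorRep_apply, Subgroup.coe_inv, map_inv, hmap]
  rw [h1, h2, Ad_placeGL_placeLie] at h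
  exact h

/-- **The Casimir operator `C^alg = ∑_{a,b} A(E_{ab}) A(E_{ba})` of `V_wt(ℂ)`.** [cite: Knapp2002, §V.4 (5.24)] -/
def casAlg : Module.End ℂ (GLnCohomology.CoeffModule ℂ n wt) :=
  ∑ a : Fin n, ∑ b : Fin n, algLie n wt w (Matrix.single a b 1) * algLie n wt w (Matrix.single b a 1)

/-- `iE_{ab} = i · E_{ab}`. [folklore] -/
theorem single_I (a b : Fin n) : Matrix.single a b I = I • Matrix.single a b (1 : ℂ) := by
  rw [Matrix.smul_single, smul_eq_mul, mul_one]

/-- The expansion `ρ(C₊) = ∑_{a,b} (ρ(E_{ab})ρ(E_{ba}) - ρ(iE_{ab})ρ(iE_{ba}))`. [folklore] -/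
theorem lift_casPlus_eq_sum {V : Type*} [AddCommGroup V] [Module ℂ V]
    (ρ : Matrix (Fin n) (Fin n) ℂ →ₗ⁅ℝ⁆ Module.End ℂ V) :
    lift ℝ ρ (casPlus n) = ∑ a, ∑ b, (ρ (Matrix.single a b 1) * ρ (Matrix.single b a 1) -
      ρ (Matrix.single a b I) * ρ (Matrix.single b a I)) := by
  rw [casPlus, casU, casU, map_sub]
  simp only [map_sum, map_mul, gen_apply, Finset.sum_sub_distrib, lift_ι_apply]

/-- The expansion `ρ(C₋) = ∑_{a,b} (ρ(E_{ab})ρ(iE_{ba}) + ρ(iE_{ab})ρ(E_{ba}))`. [folklore] -/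
theorem lift_casMinus_eq_sum {V : Type*} [AddCommGroup V] [Module ℂ V]
    (ρ : Matrix (Fin n) (Fin n) ℂ →ₗ⁅ℝ⁆ Module.End ℂ V) :
    lift ℝ ρ (casMinus n) = ∑ a, ∑ b, (ρ (Matrix.single a b 1) * ρ (Matrix.single b a I) +
      ρ (Matrix.single a b I) * ρ (Matrix.single b a 1)) := by
  rw [casMinus, casU, casU, map_add]
  simp only [map_sum, map_mul, gen_apply, Finset.sum_add_distrib, lift_ι_apply]

/-- `A(C₊) = 2 C^alg` (`A` is complex-linear). [folklore] -/
theorem lift_algLie_casPlus : lift ℝ (algLie n wt w) (casPlus n) = (2 : ℂ) • casAlg wt w := by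
  rw [lift_casPlus_eq_sum, casAlg, Finset.smul_sum]
  refine Finset.sum_congr rfl fun a _ => ?_
  rw [Finset.smul_sum]
  refine Finset.sum_congr rfl fun b _ => ?_
  rw [single_I, single_I, algLie_smul, algLie_smul, smul_mul_smul_comm, I_mul_I, neg_one_smul, sub_neg_eq_add,
    two_smul]

/-- `A(C₋) = 2i C^alg`. [folklore] -/
theorem lift_algLie_casMinus : lift ℝ (algLie n wt w) (casMinus n) = (2 * I) • casAlg wt w := by
  rw [lift_casMinus_eq_sum, casAlg, Finset.smul_sum]
  refine Finset.sum_congr rfl fun a _ => ?_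
  rw [Finset.smul_sum]
  refine Finset.sum_congr rfl fun b _ => ?_
  rw [single_I, single_I, algLie_smul, algLie_smul, mul_smul_comm, smul_mul_assoc, mul_smul, two_smul]

/-- `A(C₊)` commutes with `V_wt(GLₙ(ℂ))` (`Ad`-invariance of the `B₊`-tensor). [cite: Knapp2002, §V.4 Prop. 5.24] -/
theorem lift_algLie_casPlus_comm (g : GL (Fin n) ℂ) :
    lift ℝ (algLie n wt w) (casPlus n) ∘ₗ coeffRepGL ℂ n wt g = coeffRepGL ℂ n wt g ∘ₗ lift ℝ (algLie n wt w) (casPlus n) := by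
  set ρg := coeffRepGL ℂ n wt g with hρg
  set ρg' := coeffRepGL ℂ n wt g⁻¹ with hρg'
  have hinv : ρg' * ρg = 1 := by rw [hρg, hρg', ← map_mul, inv_mul_cancel, map_one]
  have hinv' : ρg * ρg' = 1 := by rw [hρg, hρg', ← map_mul, mul_inv_cancel, map_one]
  have hconj : ∀ Y, ρg * algLie n wt w Y * ρg' =
      algLie n wt w ((g : Matrix (Fin n) (Fin n) ℂ) * Y * ((g⁻¹ : GL (Fin n) ℂ) : Matrix (Fin n) (Fin n) ℂ)) :=
    fun Y => by rw [mul_assoc]; exact coeffRepGL_conj_algLie wt w g Y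
  have key := congrArg (TensorProduct.lift (prodBilin (algLie n wt w) (algLie n wt w)))
    (sum_adEquiv_cplxBasis_tmul_adEquiv_dualRe (n := n) g)
  simp only [map_sum, TensorProduct.lift.tmul, prodBilin_apply, adEquiv_apply] at key
  rw [sum_rho_cplxBasis_mul_rho_dualRe] at key
  -- `key : ∑ x, A(g b_x g⁻¹) A(g b_x^∨ g⁻¹) = A(C₊)`
  have hc : ρg * lift ℝ (algLie n wt w) (casPlus n) * ρg' = lift ℝ (algLie n wt w) (casPlus n) := by
    conv_lhs => rw [← sum_rho_cplxBasis_mul_rho_dualRe]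
    rw [Finset.mul_sum, Finset.sum_mul, ← key]
    refine Finset.sum_congr rfl fun x _ => ?_
    rw [← hconj, ← hconj]
    simp only [mul_assoc]
    rw [← mul_assoc ρg' ρg, hinv, one_mul]
  change lift ℝ (algLie n wt w) (casPlus n) * ρg = ρg * lift ℝ (algLie n wt w) (casPlus n)
  conv_lhs => rw [← hc]
  rw [mul_assoc (ρg * lift ℝ (algLie n wt w) (casPlus n)), hinv, mul_one]

/-- The one-part bound: `μ = λ − λ_{n−1}` has at most `n` parts. [folklore] -/
theorem card_parts_coeffPartition_le : (coeffPartition wt).parts.card ≤ Fintype.card (Fin n) := by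
  rw [coeffPartition_parts]
  exact (Multiset.card_le_card (Multiset.filter_le _ _)).trans (by simp)

/-- **`A(C₊)` is a scalar on `V_wt(ℂ)`** (Schur's lemma for the irreducible `V_wt`, `isIrreducible_weylRep_holds`).
[cite: FultonHarrisGTM129, Thm. 6.3 (4)] -/
theorem exists_lift_algLie_casPlus_eq_smul :
    ∃ p : ℂ, lift ℝ (algLie n wt w) (casPlus n) = p • (1 : Module.End ℂ (GLnCohomology.CoeffModule ℂ n wt)) := by
  haveI : FiniteDimensional ℂ (GLnCohomology.CoeffModule ℂ n wt) := finiteDimensional_coeffModule n wt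
  haveI : Representation.IsIrreducible (weylRepCoeff ℂ n wt) :=
    isIrreducible_weylRep_holds ℂ (Fin n) (coeffPartition wt) (card_parts_coeffPartition_le wt)
  set P := lift ℝ (algLie n wt w) (casPlus n) with hP
  have hcomm : ∀ g : GL (Fin n) ℂ, P ∘ₗ weylRepCoeff ℂ n wt g = weylRepCoeff ℂ n wt g ∘ₗ P := by
    intro g
    have hu : ∀ v, weylRepCoeff ℂ n wt g v =
        (((Matrix.GeneralLinearGroup.det g ^ lowestEntry wt : ℂˣ) : ℂ)⁻¹) • coeffRepGL ℂ n wt g v := fun v => by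
      rw [coeffRepGL_apply, smul_smul, inv_mul_cancel₀ (Units.ne_zero _), one_smul]
    refine LinearMap.ext fun v => ?_
    rw [LinearMap.comp_apply, LinearMap.comp_apply, hu, hu, map_smul]
    congr 1
    exact LinearMap.congr_fun (lift_algLie_casPlus_comm wt w g) v
  let f : Representation.IntertwiningMap (weylRepCoeff ℂ n wt) (weylRepCoeff ℂ n wt) := ⟨P, hcomm⟩
  obtain ⟨p, hp⟩ :=
    (Representation.IsIrreducible.algebraMap_intertwiningMap_bijective_of_isAlgClosed (ρ := weylRepCoeff ℂ n wt)).2 f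
  refine ⟨p, ?_⟩
  have h := congrArg Representation.IntertwiningMap.toLinearMap hp
  rw [Representation.IntertwiningMap.algebraMap_apply, Representation.IntertwiningMap.toLinearMap_smul] at h
  exact h.symm

/-- **`C^alg` is a scalar on `V_wt(ℂ)`.** [cite: FultonHarrisGTM129, Thm. 6.3 (4)] -/
theorem exists_casAlg_eq_smul :
    ∃ c : ℂ, casAlg wt w = c • (1 : Module.End ℂ (GLnCohomology.CoeffModule ℂ n wt)) := by
  obtain ⟨p, hp⟩ := exists_lift_algLie_casPlus_eq_smul wt w
  refine ⟨2⁻¹ * p, ?_⟩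
  rw [mul_smul, ← hp, lift_algLie_casPlus, smul_smul, inv_mul_cancel₀ two_ne_zero, one_smul]

/-! ### The restriction of `E_wt` to the factor: `C_±` and `Z(u)` through `S = slot_σ`, `T = slot_σ̄` -/

/-- Ring identity behind `ρ(C₊) = S(A C₊) + T(A C₊)`. [folklore] -/
theorem casPlus_ring_identity {R : Type*} [Ring R] [Algebra ℂ R] (Sa Ta Sa' Ta' : R) :
    (Sa + Ta) * (Sa' + Ta') - (I • Sa - I • Ta) * (I • Sa' - I • Ta') =
      (Sa * Sa' - (I • Sa) * (I • Sa')) + (Ta * Ta' - (I • Ta) * (I • Ta')) := by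
  have h : ∀ x y : R, (I • x) * (I • y) = -(x * y) := fun x y => by
    rw [smul_mul_smul_comm, I_mul_I, neg_one_smul]
  simp only [sub_mul, mul_sub, h]
  noncomm_ring

/-- Ring identity behind `ρ(C₋) = S(A C₋) - T(A C₋)`. [folklore] -/
theorem casMinus_ring_identity {R : Type*} [Ring R] [Algebra ℂ R] (Sa Ta Sa' Ta' : R) :
    (Sa + Ta) * (I • Sa' - I • Ta') + (I • Sa - I • Ta) * (Sa' + Ta') =
      (Sa * (I • Sa') + (I • Sa) * Sa') - (Ta * (I • Ta') + (I • Ta) * Ta') := by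
  simp only [mul_smul_comm, smul_mul_assoc, mul_sub, mul_add, sub_mul, add_mul, smul_add]
  abel

set_option quotPrecheck false in
/-- `S = slot_{σ_w}` (local shorthand). -/
local notation "Sσ" => PiTensor.slot (E := fun _ : (F →+* ℂ) => GLnCohomology.CoeffModule ℂ n wt) w.1.embedding
set_option quotPrecheck false in
/-- `T = slot_{σ̄_w}` (local shorthand). -/
local notation "Tσ" => PiTensor.slot (E := fun _ : (F →+* ℂ) => GLnCohomology.CoeffModule ℂ n wt)
  (ComplexEmbedding.conjugate w.1.embedding)

/-- `ρ(E_{ab}) = S(A E_{ab}) + T(A E_{ab})`, `ρ = dE_wt ∘ φ_w`. [folklore] -/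
theorem coeffLieT_placeLie_single_one (a b : Fin n) :
    coeffLieT F n wt (placeLie n w (Matrix.single a b 1)) =
      Sσ (algLie n wt w (Matrix.single a b 1)) + Tσ (algLie n wt w (Matrix.single a b 1)) := by
  rw [coeffLieT_placeLie, Matrix.map_single, map_one]

/-- `slot i (-u) = -slot i u`. [folklore] -/
theorem slot_neg' {ι : Type*} [DecidableEq ι] {E : ι → Type*} [∀ i, AddCommGroup (E i)]
    [∀ i, Module ℂ (E i)] (i : ι) (u : E i →ₗ[ℂ] E i) : PiTensor.slot (E := E) i (-u) = -PiTensor.slot (E := E) i u := by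
  have h := PiTensor.slot_sub (E := E) i 0 u
  rwa [zero_sub, slot_zero', zero_sub] at h

/-- `ρ(iE_{ab}) = i S(A E_{ab}) - i T(A E_{ab})`. [folklore] -/
theorem coeffLieT_placeLie_single_I (a b : Fin n) :
    coeffLieT F n wt (placeLie n w (Matrix.single a b I)) =
      I • Sσ (algLie n wt w (Matrix.single a b 1)) - I • Tσ (algLie n wt w (Matrix.single a b 1)) := by
  have h1 : (Matrix.single a b I).map conj = -Matrix.single a b I := by
    rw [Matrix.map_single, conj_I]
    exact map_neg (Matrix.singleLinearMap ℂ a b) I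
  have h2 : algLie n wt w (-Matrix.single a b I) = -algLie n wt w (Matrix.single a b I) :=
    ((algLie n wt w : Matrix (Fin n) (Fin n) ℂ →ₗ⁅ℝ⁆ Module.End ℂ (GLnCohomology.CoeffModule ℂ n wt)) :
      Matrix (Fin n) (Fin n) ℂ →ₗ[ℝ] Module.End ℂ (GLnCohomology.CoeffModule ℂ n wt)).map_neg _
  rw [coeffLieT_placeLie, h1, h2, slot_neg', single_I, algLie_smul, PiTensor.slot_smul, PiTensor.slot_smul,
    sub_eq_add_neg]

/-- **`dE_wt(φ_w C₊) = S(A C₊) + T(A C₊)`.** [cite: BorelWallach2000, I §4.1] -/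
theorem lift_coeffLieT_casPlus :
    lift ℝ ((coeffLieT F n wt).comp (placeLie n w)) (casPlus n) =
      Sσ (lift ℝ (algLie n wt w) (casPlus n)) + Tσ (lift ℝ (algLie n wt w) (casPlus n)) := by
  rw [lift_casPlus_eq_sum, lift_casPlus_eq_sum, slot_sum', slot_sum', ← Finset.sum_add_distrib]
  refine Finset.sum_congr rfl fun a _ => ?_
  rw [slot_sum', slot_sum', ← Finset.sum_add_distrib]
  refine Finset.sum_congr rfl fun b _ => ?_
  rw [LieHom.comp_apply, LieHom.comp_apply, LieHom.comp_apply, LieHom.comp_apply, coeffLieT_placeLie_single_one,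
    coeffLieT_placeLie_single_one, coeffLieT_placeLie_single_I, coeffLieT_placeLie_single_I]
  simp only [single_I, algLie_smul, PiTensor.slot_sub, PiTensor.slot_smul, ← PiTensor.slot_mul_same]
  exact casPlus_ring_identity _ _ _ _

/-- **`dE_wt(φ_w C₋) = S(A C₋) - T(A C₋)`.** [cite: BorelWallach2000, I §4.1] -/
theorem lift_coeffLieT_casMinus :
    lift ℝ ((coeffLieT F n wt).comp (placeLie n w)) (casMinus n) =
      Sσ (lift ℝ (algLie n wt w) (casMinus n)) - Tσ (lift ℝ (algLie n wt w) (casMinus n)) := by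
  rw [lift_casMinus_eq_sum, lift_casMinus_eq_sum, slot_sum', slot_sum', ← Finset.sum_sub_distrib]
  refine Finset.sum_congr rfl fun a _ => ?_
  rw [slot_sum', slot_sum', ← Finset.sum_sub_distrib]
  refine Finset.sum_congr rfl fun b _ => ?_
  rw [LieHom.comp_apply, LieHom.comp_apply, LieHom.comp_apply, LieHom.comp_apply, coeffLieT_placeLie_single_one,
    coeffLieT_placeLie_single_one, coeffLieT_placeLie_single_I, coeffLieT_placeLie_single_I]
  simp only [single_I, algLie_smul, PiTensor.slot_add, PiTensor.slot_smul, ← PiTensor.slot_mul_same]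
  exact casMinus_ring_identity _ _ _ _

omit [NumberField F] in
/-- `conj(u · 1) = ū · 1`. [folklore] -/
theorem map_conj_smul_one (u : ℂ) : (u • (1 : Matrix (Fin n) (Fin n) ℂ)).map conj = conj u • (1 : Matrix (Fin n) (Fin n) ℂ) := by
  ext i j
  simp [Matrix.one_apply, apply_ite conj]

/-- **`dE_wt(φ_w Z(u)) = S(A(u·1)) + T(A(ū·1))`.** [folklore] -/
theorem lift_coeffLieT_zedU (u : ℂ) :
    lift ℝ ((coeffLieT F n wt).comp (placeLie n w)) (zedU n u) =
      Sσ (algLie n wt w (u • 1)) + Tσ (algLie n wt w (conj u • 1)) := by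
  rw [zedU, lift_ι_apply, LieHom.comp_apply, coeffLieT_placeLie, map_conj_smul_one]

/-- **`A(u · 1) = u (d + n λ_{n−1})`** on `V_wt(ℂ) ⊆ (ℂⁿ)^{⊗d} ⊗ det^{λ_{n−1}}`. [folklore] -/
theorem algLie_smul_one (u : ℂ) :
    algLie n wt w (u • 1) = (u * ((coeffDegree wt : ℂ) + n * (lowestEntry wt : ℂ))) •
      (1 : Module.End ℂ (GLnCohomology.CoeffModule ℂ n wt)) := by
  refine LinearMap.ext fun v => tens_injective wt ?_
  rw [tens_algLie, leib_smul_one, Matrix.trace_smul, Matrix.trace_one, Fintype.card_fin]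
  simp only [LinearMap.smul_apply, Module.End.one_apply, tens_smul, smul_eq_mul, ← add_smul]
  congr 1
  ring

/-- **The scalars of the factor at `w` on `E_wt`, given `C^alg = c`**: `C₊ ↦ 4c`. [cite: BorelWallach2000, I §4.1] -/
theorem lift_coeffLieT_casPlus_of_casAlg {c : ℂ} (hc : casAlg wt w = c • 1) :
    lift ℝ ((coeffLieT F n wt).comp (placeLie n w)) (casPlus n) = (4 * c) • 1 := by
  rw [lift_coeffLieT_casPlus, lift_algLie_casPlus, hc, smul_smul, PiTensor.slot_smul, PiTensor.slot_smul, slot_one',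
    slot_one', ← add_smul]
  congr 1
  ring

/-- `C₋ ↦ 0`. [cite: BorelWallach2000, I §4.1] -/
theorem lift_coeffLieT_casMinus_of_casAlg {c : ℂ} (hc : casAlg wt w = c • 1) :
    lift ℝ ((coeffLieT F n wt).comp (placeLie n w)) (casMinus n) = 0 := by
  rw [lift_coeffLieT_casMinus, lift_algLie_casMinus, hc, smul_smul, PiTensor.slot_smul, PiTensor.slot_smul, slot_one',
    slot_one', sub_self]

/-- `Z(u) ↦ (u + ū)(d + n λ_{n−1})`. [folklore] -/
theorem lift_coeffLieT_zedU_eq (u : ℂ) :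
    lift ℝ ((coeffLieT F n wt).comp (placeLie n w)) (zedU n u) =
      ((u + conj u) * ((coeffDegree wt : ℂ) + n * (lowestEntry wt : ℂ))) • 1 := by
  rw [lift_coeffLieT_zedU, algLie_smul_one, algLie_smul_one, PiTensor.slot_smul, PiTensor.slot_smul, slot_one',
    slot_one', ← add_smul, ← add_mul]

end Coefficients

/-! ## `n = 2`: the value of `C^alg` on `V_wt(ℂ) = Sym^d(ℂ²) ⊗ det^m` -/

section TwoByTwo

open RealMatrixGroup ParallelWeight GLnCohomology Literature.NumberTheory.DiophantineGeometry PiTensor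

variable {F : Type} [Field F] [NumberField F] (wt : Fin 2 → ℤ) (w : {w : InfinitePlace F // IsComplex w})

/-- `λ₁` is the lowest entry. [folklore] -/
theorem lowestEntry_two : lowestEntry wt = wt 1 := rfl

/-- `λ₁ - λ₁ = 0`: the second shifted entry vanishes. [folklore] -/
theorem polyShift_one : polyShift wt 1 = 0 := by
  simp [polyShift]

/-- The degree `d = λ₀ - λ₁` (as a natural number). [folklore] -/
theorem coeffDegree_two : coeffDegree wt = (wt 0 - wt 1).toNat := by
  rw [coeffDegree, Fin.sum_univ_two, polyShift_one, add_zero, polyShift, lowestEntry_two]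

/-- For dominant `λ`, `d = λ₀ - λ₁` in `ℤ`. [folklore] -/
theorem coeffDegree_two_cast (hwt : Weight.IsDominant wt) : ((coeffDegree wt : ℕ) : ℤ) = wt 0 - wt 1 := by
  rw [coeffDegree_two, Int.toNat_of_nonneg (sub_nonneg.mpr (hwt (Fin.zero_le _)))]

/-- The partition `μ = (d)` has at most one part. [folklore] -/
theorem card_parts_coeffPartition_two_le_one : (coeffPartition wt).parts.card ≤ 1 := by
  rw [coeffPartition_parts, Multiset.filter_map, Multiset.card_map]
  calc (Multiset.filter ((fun x : ℕ => x ≠ 0) ∘ polyShift wt) Finset.univ.val).card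
      ≤ (({0} : Finset (Fin 2)).val).card := by
        refine Multiset.card_le_card (Multiset.le_iff_subset (Multiset.Nodup.filter _ Finset.univ.nodup) |>.mpr ?_)
        intro i hi
        rw [Multiset.mem_filter] at hi
        fin_cases i
        · simp
        · exact absurd (polyShift_one wt) hi.2
    _ = 1 := rfl

/-- A partition with at most one part is the one-row partition. [folklore] -/
theorem eq_indiscrete_of_card_le_one {d : ℕ} (μ : Nat.Partition d) (h : μ.parts.card ≤ 1) :
    μ = Nat.Partition.indiscrete d := by
  ext1
  change μ.parts = Multiset.filter (· ≠ 0) {d}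
  rcases Nat.le_one_iff_eq_zero_or_eq_one.mp h with h0 | h1
  · have hp : μ.parts = 0 := Multiset.card_eq_zero.mp h0
    have hd : d = 0 := by rw [← μ.parts_sum, hp, Multiset.sum_zero]
    subst hd
    rw [hp]; decide
  · obtain ⟨a, ha⟩ := Multiset.card_eq_one.mp h1
    have hd : d = a := by rw [← μ.parts_sum, ha, Multiset.sum_singleton]
    subst hd
    have hpos : d ≠ 0 := (μ.parts_pos (by rw [ha]; exact Multiset.mem_singleton_self _)).ne'
    rw [ha, Multiset.filter_singleton, if_pos hpos]

/-- `μ = (d)` for `n = 2`. [folklore] -/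
theorem coeffPartition_two : coeffPartition wt = Nat.Partition.indiscrete (coeffDegree wt) :=
  eq_indiscrete_of_card_le_one _ (card_parts_coeffPartition_two_le_one wt)

/-- The highest weight tensor `e₀^{⊗d}`. [cite: FultonYoungTableaux1997, §8.2 Lemma 4] -/
def hwTensor : TensorPower ℂ (coeffDegree wt) (Fin 2 → ℂ) :=
  PiTensorProduct.tprod ℂ fun _ : Fin (coeffDegree wt) => Pi.single (0 : Fin 2) (1 : ℂ)

/-- `e₀^{⊗d}` is the basis tensor `e_{(0,…,0)}`. [folklore] -/
theorem hwTensor_eq : hwTensor wt = tensorBasis ℂ (Fin 2) (coeffDegree wt) (fun _ => 0) := by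
  rw [tensorBasis_apply, hwTensor]
  simp only [Pi.basisFun_apply]

/-- `e₀^{⊗d} ≠ 0` (a basis tensor). [folklore] -/
theorem hwTensor_ne_zero : hwTensor wt ≠ 0 := by
  rw [hwTensor_eq]
  exact Module.Basis.ne_zero _ _

/-- Every permutation fixes `e₀^{⊗d}`. [folklore] -/
theorem permTensorRep_hwTensor (τ : Equiv.Perm (Fin (coeffDegree wt))) :
    permTensorRep ℂ (Fin 2 → ℂ) (coeffDegree wt) τ (hwTensor wt) = hwTensor wt := by
  rw [hwTensor, permTensorRep_tprod]

/-- `e₀^{⊗d} ∈ S_{(d)}(ℂ²) = Sym^d` (it is `(d!)⁻¹ ∑_g g · e₀^{⊗d}`). [cite: FultonHarrisGTM129, §6.1 Thm. 6.3] -/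
theorem hwTensor_mem : hwTensor wt ∈ weylModule ℂ (Fin 2) (coeffPartition wt) := by
  rw [coeffPartition_two, weylModule_indiscrete]
  refine ⟨((Fintype.card (Equiv.Perm (Fin (coeffDegree wt))) : ℂ))⁻¹ • hwTensor wt, ?_⟩
  rw [map_smul, symmetrizeT_apply]
  simp only [permTensorRep_hwTensor, Finset.sum_const, Finset.card_univ]
  rw [← Nat.cast_smul_eq_nsmul ℂ, smul_smul, inv_mul_cancel₀ (Nat.cast_ne_zero.mpr Fintype.card_ne_zero), one_smul]

/-- The highest weight vector `v⁺ = e₀^{⊗d} ∈ V_wt(ℂ)`. [cite: FultonYoungTableaux1997, §8.2 Lemma 4] -/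
def hwVec : GLnCohomology.CoeffModule ℂ 2 wt := ofTens wt (hwTensor wt) (hwTensor_mem wt)

/-- `v⁺ ≠ 0`. [folklore] -/
theorem hwVec_ne_zero : hwVec wt ≠ 0 := fun h =>
  hwTensor_ne_zero wt (by rw [← tens_ofTens wt (hwTensor wt) (hwTensor_mem wt), ← hwVec, h, tens_zero])

/-- `E_{a0} e₀ = e_a`, `E_{a1} e₀ = 0`. [folklore] -/
theorem single_mulVec_e0 (a b : Fin 2) :
    Matrix.single a b (1 : ℂ) *ᵥ Pi.single (0 : Fin 2) (1 : ℂ) = if b = 0 then Pi.single a 1 else 0 := by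
  rw [Matrix.single_mulVec, one_mul]
  split_ifs with hb
  · subst hb; rw [Pi.single_eq_same]; rfl
  · rw [Pi.single_eq_of_ne hb]
    exact Function.update_eq_self a _

/-- `L(E₀₀) e₀^{⊗d} = d e₀^{⊗d}`. [folklore] -/
theorem leib_E00_hwTensor : leib 2 (coeffDegree wt) (Matrix.single 0 0 1) (hwTensor wt) = (coeffDegree wt : ℂ) • hwTensor wt := by
  rw [hwTensor, leib_tprod]
  simp only [single_mulVec_e0, ↓reduceIte, Function.update_eq_self, Finset.sum_const, Finset.card_univ,
    Fintype.card_fin]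
  rw [Nat.cast_smul_eq_nsmul]

/-- `L(E₁₁) e₀^{⊗d} = 0`, `L(E₀₁) e₀^{⊗d} = 0`. [folklore] -/
theorem leib_Ea1_hwTensor (a : Fin 2) : leib 2 (coeffDegree wt) (Matrix.single a 1 1) (hwTensor wt) = 0 := by
  rw [hwTensor, leib_tprod]
  refine Finset.sum_eq_zero fun i _ => ?_
  rw [single_mulVec_e0, if_neg one_ne_zero]
  exact (PiTensorProduct.tprod ℂ).map_update_zero _ i

/-- `A(E₀₀) v⁺ = (d + m) v⁺`. [folklore] -/
theorem algLie_E00_hwVec :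
    algLie 2 wt w (Matrix.single 0 0 1) (hwVec wt) = ((coeffDegree wt : ℂ) + (wt 1 : ℂ)) • hwVec wt := by
  refine tens_injective wt ?_
  rw [tens_algLie, tens_smul, hwVec, tens_ofTens, leib_E00_hwTensor, Matrix.trace_single_eq_same, mul_one,
    lowestEntry_two, ← add_smul]

/-- `A(E₁₁) v⁺ = m v⁺`. [folklore] -/
theorem algLie_E11_hwVec : algLie 2 wt w (Matrix.single 1 1 1) (hwVec wt) = (wt 1 : ℂ) • hwVec wt := by
  refine tens_injective wt ?_
  rw [tens_algLie, tens_smul, hwVec, tens_ofTens, leib_Ea1_hwTensor, Matrix.trace_single_eq_same, mul_one,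
    lowestEntry_two, zero_add]

/-- `A(E₀₁) v⁺ = 0` (`v⁺` is a highest weight vector). [folklore] -/
theorem algLie_E01_hwVec : algLie 2 wt w (Matrix.single 0 1 1) (hwVec wt) = 0 := by
  refine tens_injective wt ?_
  rw [tens_algLie, hwVec, tens_ofTens, leib_Ea1_hwTensor, Matrix.trace_single_eq_of_ne _ _ _ zero_ne_one, mul_zero,
    zero_smul, add_zero, tens_zero]

/-- `A(E₀₁) A(E₁₀) v⁺ = d v⁺` (`[E₀₁, E₁₀] = E₀₀ - E₁₁`). [folklore] -/
theorem algLie_E01_E10_hwVec :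
    algLie 2 wt w (Matrix.single 0 1 1) (algLie 2 wt w (Matrix.single 1 0 1) (hwVec wt)) =
      (coeffDegree wt : ℂ) • hwVec wt := by
  have hlie : ⁅Matrix.single (0 : Fin 2) (1 : Fin 2) (1 : ℂ), (Matrix.single 1 0 1 : Matrix (Fin 2) (Fin 2) ℂ)⁆ =
      Matrix.single 0 0 1 - Matrix.single 1 1 1 := by
    rw [Ring.lie_def, Matrix.single_mul_single_same, Matrix.single_mul_single_same, mul_one]
  have h := LinearMap.congr_fun (LieHom.map_lie (algLie 2 wt w) (Matrix.single 0 1 1) (Matrix.single 1 0 1)) (hwVec wt)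
  rw [hlie, map_sub, LinearMap.sub_apply, algLie_E00_hwVec, algLie_E11_hwVec, Ring.lie_def, LinearMap.sub_apply,
    Module.End.mul_apply, Module.End.mul_apply, algLie_E01_hwVec, map_zero, sub_zero] at h
  rw [← h, ← sub_smul, add_sub_cancel_right]

/-- **The Casimir scalar of `V_wt(ℂ)`, `n = 2`**: `C^alg v⁺ = (d² + d + 2dm + 2m²) v⁺`. [cite: Knapp2002, §V.4 (5.24)] -/
theorem casAlg_hwVec :
    casAlg wt w (hwVec wt) = ((coeffDegree wt : ℂ) ^ 2 + coeffDegree wt + 2 * (coeffDegree wt) * (wt 1 : ℂ) +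
      2 * (wt 1 : ℂ) ^ 2) • hwVec wt := by
  rw [casAlg, LinearMap.sum_apply, Fin.sum_univ_two, LinearMap.sum_apply, LinearMap.sum_apply, Fin.sum_univ_two,
    Fin.sum_univ_two]
  simp only [Module.End.mul_apply, algLie_E00_hwVec, algLie_E11_hwVec, algLie_E01_hwVec, algLie_E01_E10_hwVec,
    map_smul, map_zero, smul_smul, ← add_smul, zero_add]
  congr 1
  ring

/-- **`C^alg = (λ₀² + λ₁² + λ₀ - λ₁) · 1` on `V_wt(ℂ)`** for dominant `λ = wt` (`n = 2`).
[cite: Knapp2002, §V.4 (5.24); FultonHarrisGTM129, Thm. 6.3 (4)] -/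
theorem casAlg_two_eq (hwt : Weight.IsDominant wt) :
    casAlg wt w = ((wt 0 : ℂ) ^ 2 + (wt 1 : ℂ) ^ 2 + wt 0 - wt 1) • (1 : Module.End ℂ (GLnCohomology.CoeffModule ℂ 2 wt)) := by
  obtain ⟨c, hc⟩ := exists_casAlg_eq_smul wt w
  have h := casAlg_hwVec wt w
  rw [hc, LinearMap.smul_apply, Module.End.one_apply] at h
  have hc' := smul_left_injective ℂ (hwVec_ne_zero wt) h
  have hd : ((coeffDegree wt : ℕ) : ℂ) = (wt 0 : ℂ) - (wt 1 : ℂ) := by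
    have := coeffDegree_two_cast wt hwt
    exact_mod_cast this
  rw [hc, hc', hd]
  congr 1
  ring

/-- **The scalars of the factor at `w` on `E_wt` (`n = 2`, `wt` dominant):** `C₊,w ↦ 4(λ₀² + λ₁² + λ₀ - λ₁)`.
[cite: BorelWallach2000, I §4.1] -/
theorem archCoeffLie_lift_casPlus (hwt : Weight.IsDominant wt) (e : ParallelWeight.CoeffModule ℂ F 2 wt) :
    lift ℝ ((archCoeffLie F 2 wt).comp (placeLie 2 w)) (casPlus 2) e =
      (4 * ((wt 0 : ℂ) ^ 2 + (wt 1 : ℂ) ^ 2 + wt 0 - wt 1)) • e :=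
  LinearMap.congr_fun (lift_coeffLieT_casPlus_of_casAlg wt w (casAlg_two_eq wt w hwt)) e

/-- `C₋,w ↦ 0`. [cite: BorelWallach2000, I §4.1] -/
theorem archCoeffLie_lift_casMinus (hwt : Weight.IsDominant wt) (e : ParallelWeight.CoeffModule ℂ F 2 wt) :
    lift ℝ ((archCoeffLie F 2 wt).comp (placeLie 2 w)) (casMinus 2) e = (0 : ℂ) • e := by
  rw [zero_smul]
  exact LinearMap.congr_fun (lift_coeffLieT_casMinus_of_casAlg wt w (casAlg_two_eq wt w hwt)) e

/-- `Z_w(u) ↦ (u + ū)(λ₀ + λ₁)`. [folklore] -/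
theorem archCoeffLie_lift_zedU (hwt : Weight.IsDominant wt) (u : ℂ) (e : ParallelWeight.CoeffModule ℂ F 2 wt) :
    lift ℝ ((archCoeffLie F 2 wt).comp (placeLie 2 w)) (zedU 2 u) e = ((u + conj u) * ((wt 0 : ℂ) + wt 1)) • e := by
  have h := LinearMap.congr_fun (lift_coeffLieT_zedU_eq wt w u) e
  have hd : ((coeffDegree wt : ℕ) : ℂ) = (wt 0 : ℂ) - (wt 1 : ℂ) := by
    have := coeffDegree_two_cast wt hwt
    exact_mod_cast this
  rw [hd, lowestEntry_two, show ((wt 0 : ℂ) - wt 1 + (2 : ℕ) * (wt 1 : ℂ)) = wt 0 + wt 1 by push_cast; ring] at h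
  exact h

end TwoByTwo

end ComplexPlace

end Literature.NumberTheory.Automorphic

end
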